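import Literature.Probability.LatticeModels.IsingFieldGKS
import Literature.Probability.LatticeModels.GKSInequalities
import Literature.Probability.LatticeModels.IsingTranslationInvariance
import Literature.Probability.LatticeModels.MagnetizationExponentUpper
import Literature.Probability.LatticeModels.SharpnessProofs
import HarnessLib

/-!
# Route SynchronousCoupling · crux `UniformRegularity` (stmt-CriticalPhenomena-4658) ·
# line `Sketch` (magnetic ruler) · stub 2 `stub_ghsSandwich`

The UPPER half of the field sandwich of the magnetic-ruler line (GHS / Lebowitz 1974): for the
nearest-neighbour Ising model on `ℤ³` at `β = β_c`, a uniform field `h ≥ 0` and `x ≠ 0`,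

  `S_h(x) = ⟨σ₀σ_x⟩⁺_{β_c,h} ≤ ⟨σ₀σ_x⟩⁺_{β_c,0} + (⟨σ₀⟩⁺_{β_c,h})² = g(x) + M(h)²`.

**Proof.** Finite volume first. In a box `Λ = Λ(L) ∋ 0, x` with `+` boundary condition, along the
constant-field ray `s ↦ affCpl 0 1 s = (s, …, s)` the truncated pair function
`⟨σ₀σ_x⟩⁺_{Λ;β,s} - ⟨σ₀⟩⁺_{Λ;β,s}⟨σ_x⟩⁺_{Λ;β,s}` is nonincreasing on `[0, ∞)` — the GHS inequality
integrated along the ray (Lebowitz 1974, §2, Remark (ii): "for `h ≥ 0` the truncated pair function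
is a decreasing function of the external fields"; tree `antitoneOn_fieldTrunc_ray` of
`IsingFieldGKS`, read at a constant field through `fieldExpect_const`). Hence its value at `h` is at
most its value at `0` (`StubGhsSandwich.isingCorr_trunc_plus_le_zeroField`). Then `L → ∞` along
boxes (`hasBoxLimit_isingCorr_plus_holds` for the observables `{0,x}`, `{0}`, `{x}`, limits of
differences and products, `le_of_tendsto_of_tendsto`):
`⟨σ₀σ_x⟩⁺_h - ⟨σ₀⟩⁺_h⟨σ_x⟩⁺_h ≤ ⟨σ₀σ_x⟩⁺_0 - ⟨σ₀⟩⁺_0⟨σ_x⟩⁺_0 ≤ ⟨σ₀σ_x⟩⁺_0` (the subtracted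
product is `≥ 0` by GKS I, `plusCorr_nonneg`); finally `⟨σ_x⟩⁺_h = ⟨σ₀⟩⁺_h = M(h)` by translation
invariance of the plus state (`plusCorr_shift`), `⟨σ₀⟩⁺_{β,h} = ⟨σ_{{0}}⟩⁺_{β,h}`
(`magnetizationInField_eq_plusCorr`) and `g(x) = ⟨σ_{{0,x}}⟩⁺_{β_c,0}` (`twoPointPlus_eq_plusCorr`).

References: J. L. Lebowitz, *GHS and other inequalities*, Comm. Math. Phys. 35 (1974) 87–92, §2
Remark (ii) [Lebowitz1974]; R. Fernández, J. Fröhlich, A. D. Sokal, *Random Walks, Critical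
Phenomena, and Triviality in Quantum Field Theory* (Springer 1992), §12.4, (12.129) [FFS1992];
S. Friedli, Y. Velenik, *Statistical Mechanics of Lattice Systems* (CUP 2017), §3.7, Thm. 3.17
[FriedliVelenik2017].
-/

noncomputable section

open scoped BigOperators Topology
open Filter Set
open Literature.Probability.LatticeModels

namespace Summit.CriticalPhenomena.Ising3DConformalLimit.Theorems.MagneticRuler

namespace StubGhsSandwich

/-- The constant-field ray: `affCpl 0 1 s` is the uniform field `s` on `ℤ³`. [folklore] -/
theorem affCpl_zero_one (s : ℝ) :
    affCpl (0 : Site 3 → ℝ) (fun _ => (1 : ℝ)) s = fun _ => s := by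
  funext i
  simp [affCpl]

/-- `σ_{{y}} = σ_y` as observables. [folklore] -/
theorem spinProduct_singleton_eq_spinAt (y : Site 3) :
    spinProduct ({y} : Finset (Site 3)) = spinAt y := by
  funext s
  simp [spinProduct]

/-- **Finite-volume GHS monotonicity in a uniform field** (Lebowitz 1974, §2, Remark (ii)): with
`+` boundary condition on a finite `Λ ⊆ ℤ³`, `β ≥ 0`, `0 ≤ h`, `0, x ∈ Λ` and `x ≠ 0`, the truncated
pair correlation `⟨σ_{{0,x}}⟩ - ⟨σ_{{0}}⟩⟨σ_{{x}}⟩` at field `h` is at most the one at field `0`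
(the truncated pair function is nonincreasing along the constant-field ray,
`antitoneOn_fieldTrunc_ray`). [cite: Lebowitz1974, §2, Remark (ii) following the proof of the Theorem] -/
theorem isingCorr_trunc_plus_le_zeroField {β h : ℝ} (hβ : 0 ≤ β) (hh : 0 ≤ h)
    {Λ : Finset (Site 3)} {x : Site 3} (hx : x ≠ 0) (h0 : (0 : Site 3) ∈ Λ) (hxΛ : x ∈ Λ) :
    isingCorr (zdGraph 3) Λ β h .plus {0, x} -
        isingCorr (zdGraph 3) Λ β h .plus {0} * isingCorr (zdGraph 3) Λ β h .plus {x} ≤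
      isingCorr (zdGraph 3) Λ β 0 .plus {0, x} -
        isingCorr (zdGraph 3) Λ β 0 .plus {0} * isingCorr (zdGraph 3) Λ β 0 .plus {x} := by
  have hanti := antitoneOn_fieldTrunc_ray (zdGraph 3) (Λ := Λ) hβ (b := (0 : Site 3 → ℝ))
    (v := fun _ => (1 : ℝ)) (fun _ _ => le_rfl) (fun _ _ => zero_le_one) (bc := .plus) (Or.inr rfl)
    h0 hxΛ
  have key := hanti Set.self_mem_Ici (Set.mem_Ici.2 hh) hh
  simp only [affCpl_zero_one, fieldExpect_const] at key
  simp only [isingCorr, spinProduct_singleton_eq_spinAt]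
  rw [← spinPair_eq_spinProduct (Ne.symm hx)]
  exact key

/-- Translation invariance of the one-point function of the plus state in a field:
`⟨σ_{{x}}⟩⁺_{β,h} = ⟨σ_{{0}}⟩⁺_{β,h}` for `β, h ≥ 0` (`plusCorr_shift` with `{x} = {0} + x`).
[cite: FriedliVelenik2017, Thm. 3.17, p. 106] -/
theorem plusCorr_singleton_eq_plusCorr_zero {β h : ℝ} (hβ : 0 ≤ β) (hh : 0 ≤ h) (x : Site 3) :
    plusCorr 3 β h {x} = plusCorr 3 β h {0} := by
  rw [← plusCorr_shift 3 hβ hh x {0}, Finset.map_singleton]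
  simp

/-- **The GHS upper sandwich in the thermodynamic limit**: for `β, h ≥ 0` and `x ≠ 0` on `ℤ³`,
`⟨σ_{{0,x}}⟩⁺_{β,h} - ⟨σ_{{0}}⟩⁺_{β,h}⟨σ_{{x}}⟩⁺_{β,h} ≤ ⟨σ_{{0,x}}⟩⁺_{β,0} - ⟨σ_{{0}}⟩⁺_{β,0}⟨σ_{{x}}⟩⁺_{β,0}`
(finite-volume GHS monotonicity passed to the limit along boxes).
[cite: Lebowitz1974, §2, Remark (ii) following the proof of the Theorem] -/
theorem plusCorr_trunc_le_zeroField {β h : ℝ} (hβ : 0 ≤ β) (hh : 0 ≤ h) {x : Site 3} (hx : x ≠ 0) :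
    plusCorr 3 β h {0, x} - plusCorr 3 β h {0} * plusCorr 3 β h {x} ≤
      plusCorr 3 β 0 {0, x} - plusCorr 3 β 0 {0} * plusCorr 3 β 0 {x} := by
  have lim_pair_h := hasBoxLimit_isingCorr_plus_holds (d := 3) hβ hh {0, x}
  have lim_zero_h := hasBoxLimit_isingCorr_plus_holds (d := 3) hβ hh ({0} : Finset (Site 3))
  have lim_x_h := hasBoxLimit_isingCorr_plus_holds (d := 3) hβ hh ({x} : Finset (Site 3))
  have lim_pair_0 := hasBoxLimit_isingCorr_plus_holds (d := 3) hβ le_rfl {0, x}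
  have lim_zero_0 := hasBoxLimit_isingCorr_plus_holds (d := 3) hβ le_rfl ({0} : Finset (Site 3))
  have lim_x_0 := hasBoxLimit_isingCorr_plus_holds (d := 3) hβ le_rfl ({x} : Finset (Site 3))
  obtain ⟨L₀, hL₀⟩ := exists_forall_subset_box 3 ({0, x} : Finset (Site 3))
  refine le_of_tendsto_of_tendsto (lim_pair_h.sub (lim_zero_h.mul lim_x_h))
    (lim_pair_0.sub (lim_zero_0.mul lim_x_0)) ?_
  filter_upwards [eventually_ge_atTop L₀] with L hL
  have hsub := hL₀ L hL
  have h0L : (0 : Site 3) ∈ box 3 L := hsub (by simp)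
  have hxL : x ∈ box 3 L := hsub (by simp)
  exact isingCorr_trunc_plus_le_zeroField hβ hh hx h0L hxL

end StubGhsSandwich

open StubGhsSandwich in
/-- **Stub 2 of line `Sketch` (magnetic ruler, crux stmt-CriticalPhenomena-4658) — the GHS/Lebowitz
upper sandwich at `β_c` on `ℤ³`**: for `h ≥ 0` and `x ≠ 0`,
`⟨σ₀σ_x⟩⁺_{β_c,h} ≤ ⟨σ₀σ_x⟩⁺_{β_c,0} + (⟨σ₀⟩⁺_{β_c,h})²`. The truncated plus two-point function is
nonincreasing in the uniform field `h ≥ 0` (GHS, finite volume, then `L → ∞`), at `h = 0` it is at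
most `g(x)` (GKS I), and `⟨σ_x⟩⁺_{β_c,h} = ⟨σ₀⟩⁺_{β_c,h} = M(h)` (translation invariance).
[cite: Lebowitz1974, §2, Remark (ii) following the proof of the Theorem]
[cite: FriedliVelenik2017, Thm. 3.17, p. 106] -/
theorem stub_ghsSandwich :
    ∀ h : ℝ, 0 ≤ h → ∀ x : Literature.Probability.LatticeModels.Site 3, x ≠ 0 →
      Literature.Probability.LatticeModels.plusCorr 3 (Literature.Probability.LatticeModels.criticalBeta 3) h {0, x} ≤
        Literature.Probability.LatticeModels.criticalTwoPoint 3 x +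
          (Literature.Probability.LatticeModels.magnetizationInField 3
            (Literature.Probability.LatticeModels.criticalBeta 3) h) ^ 2 := by
  intro h hh x hx
  have hβ : 0 ≤ criticalBeta 3 := criticalBeta_nonneg 3
  have hineq := plusCorr_trunc_le_zeroField hβ hh hx
  rw [plusCorr_singleton_eq_plusCorr_zero hβ hh x] at hineq
  have hnonneg : 0 ≤ plusCorr 3 (criticalBeta 3) 0 {0} * plusCorr 3 (criticalBeta 3) 0 {x} :=
    mul_nonneg (plusCorr_nonneg hβ le_rfl _) (plusCorr_nonneg hβ le_rfl _)
  have hg : criticalTwoPoint 3 x = plusCorr 3 (criticalBeta 3) 0 {0, x} :=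
    twoPointPlus_eq_plusCorr (criticalBeta 3) hx
  rw [hg, magnetizationInField_eq_plusCorr, sq]
  linarith

end Summit.CriticalPhenomena.Ising3DConformalLimit.Theorems.MagneticRuler

end
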